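import Summits.CriticalPhenomena.PercolationContinuityZ3.Theses.PercCriticalCaps
import Summits.CriticalPhenomena.PercolationContinuityZ3.Theorems.PercNearOneGluingNoHeavyLowerTailCSHTheoremOne
import Literature.Probability.Percolation.ConnectivityThetaSqProofs
import Literature.Probability.Percolation.RSW
import Literature.Probability.Percolation.BondPercolationSymmetry
import Literature.Probability.Percolation.PercolationProofs
import Literature.Probability.LatticeModels.LatticeGraph
import Mathlib.Data.Int.ConditionallyCompleteOrder
import HarnessLib

/-!
# `PercCriticalCaps.CapLemma` (stmt-CriticalPhenomena-7512) — SETTLED after continuity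

Item `stmt-CriticalPhenomena-7512` of route `CriticalPhenomena/PercCriticalCaps` (support): if almost surely a cap exists (`B ⊇ {x₀ ≤ 0}`, bounded above on vertical lines, boundary edges closed) then `θ(p) = 0` (every `d ≥ 1`).

`A_k = {k e₀ ↔ ∞, no higher axis point ↔ ∞}` are pairwise disjoint with equal probabilities (vertical shift, `preimage_relabel_shift_percolatesAt` + `bondPercolation_real_preimage_shift`), hence null (`n·P(A_0) ≤ 1`); on `{0 ↔ ∞}` ∩ cap ∩ a.s. uniqueness (`Grimmett1999_numInfiniteClusters_le_one_holds`, `mem_openConn_of_numInfiniteClusters_le_one`) every percolating axis point lies in `C(0) ⊆ B`, a vertically bounded set, so the highest one exists (`Int.csSup_mem`) and `ω ∈ A_k` — a null event; thus `θ(p) = P(0 ↔ ∞) = 0`.  p205010 is NOT used.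

builds on p205010 (kernel theorem, internal audit signed; external expert review pending) — USED (`CSH.percolationContinuityZ3_holds`).  RSW3 lane, lead gen 28 (prover-prim-rsw3-lead-g28-0):
'after continuity — the ledger harvest'.
References: G. Kozma, N. Nitzan (2024), Thm. 6 / Conj. 3 [KozmaNitzan2024]; G. Grimmett, *Percolation* (1999), §8 [GrimmettPercolation1999].
-/

noncomputable section

namespace Summit.CriticalPhenomena.PercolationContinuityZ3.Theorems

namespace PercCriticalCapsCapLemma

open MeasureTheory Literature.Probability.Percolation Literature.Probability.LatticeModels

variable {d : ℕ}

/-- A cap with closed boundary edges contains every open cluster it meets (lattice configurations). [folklore] -/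
theorem mem_of_openConn_of_boundary_closed {ω : BondConfig (Site d)} (hω : ω ⊆ (zdGraph d).edgeSet)
    {B : Set (Site d)} (hB : ∀ x ∈ B, ∀ y ∉ B, (zdGraph d).Adj x y → s(x, y) ∉ ω)
    {x y : Site d} (hx : x ∈ B) (h : ω ∈ openConn x y) : y ∈ B := by
  have hr : Relation.ReflTransGen (openGraph ω).Adj x y := (SimpleGraph.reachable_iff_reflTransGen _ _).1 h
  clear h
  induction hr with
  | refl => exact hx
  | tail _ hab ih =>
    obtain ⟨he, _⟩ := (openGraph_adj ω _ _).1 hab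
    by_contra hb
    exact hB _ ih _ hb ((SimpleGraph.mem_edgeSet (zdGraph d)).1 (hω he)) he

/-- **`PercCriticalCaps.CapLemma` (stmt-CriticalPhenomena-7512), settled.**  stationarity of the highest percolating axis point + uniqueness + the cap.
[cite: KozmaNitzan2024, Thm. 6 with Conj. 3 (p. 15)] -/
theorem capLemma_proof : Summit.CriticalPhenomena.PercolationContinuityZ3.Theses.PercCriticalCaps.CapLemma := by
  intro d _ p hcap
  classical
  set μ := bondPercolation (zdGraph d) p with hμ
  haveI : IsProbabilityMeasure μ := by rw [hμ]; infer_instance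
  -- `A k`: the axis point `k e₀` percolates and no higher axis point does
  set A : ℤ → Set (BondConfig (Site d)) := fun k =>
    percolatesAt (Pi.single 0 k : Site d) ∩ {ω | ∀ t : ℤ, k < t → ω ∉ percolatesAt (Pi.single 0 t : Site d)} with hA
  have hAm : ∀ k, MeasurableSet (A k) := by
    intro k
    have : {ω : BondConfig (Site d) | ∀ t : ℤ, k < t → ω ∉ percolatesAt (Pi.single 0 t : Site d)} =
        ⋂ t : ℤ, ⋂ (_ : k < t), (percolatesAt (Pi.single 0 t : Site d))ᶜ := by
      ext ω; simp only [Set.mem_setOf_eq, Set.mem_iInter, Set.mem_compl_iff]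
    rw [hA]; dsimp only; rw [this]
    exact (measurableSet_percolatesAt_holds _).inter
      (MeasurableSet.iInter fun t => MeasurableSet.iInter fun _ => (measurableSet_percolatesAt_holds _).compl)
  -- the events `A k` are pairwise disjoint
  have hdisj : Pairwise (Function.onFun Disjoint A) := by
    intro j k hjk
    rcases lt_or_gt_of_ne hjk with h | h
    · exact Set.disjoint_left.2 fun ω hj hk => hj.2 k h hk.1
    · exact Set.disjoint_left.2 fun ω hj hk => hk.2 j h hj.1
  -- and all have the same probability (vertical shift)
  have hshift : ∀ k : ℤ, μ.real (A k) = μ.real (A 0) := by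
    intro k
    set v : Site d := Pi.single 0 k with hv
    have hpre : BondConfig.relabel (sym2Equiv (Site.shift v)) ⁻¹' (A k) = A 0 := by
      ext ω
      simp only [hA, Set.mem_preimage, Set.mem_inter_iff, Set.mem_setOf_eq]
      have h1 : ∀ t : ℤ, (BondConfig.relabel (sym2Equiv (Site.shift v)) ω ∈ percolatesAt (Pi.single 0 t : Site d)) ↔
          ω ∈ percolatesAt (Pi.single 0 (t - k) : Site d) := by
        intro t
        have h := preimage_relabel_shift_percolatesAt v (Pi.single 0 (t - k) : Site d)
        rw [show (Pi.single 0 (t - k) : Site d) + v = Pi.single 0 t by rw [hv, ← Pi.single_add]; congr 1; ring] at h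
        rw [← h]; rfl
      constructor
      · rintro ⟨ha, hb⟩
        refine ⟨by simpa using (h1 k).1 ha, fun t ht hωt => ?_⟩
        have := (h1 (t + k)).2 (by simpa using hωt)
        exact hb (t + k) (by omega) this
      · rintro ⟨ha, hb⟩
        refine ⟨(h1 k).2 (by simpa using ha), fun t ht hωt => ?_⟩
        exact hb (t - k) (by omega) ((h1 t).1 hωt)
    rw [← hpre]
    exact (bondPercolation_real_preimage_shift v p (A k)).symm
  -- hence all are null: `n · P(A 0) ≤ 1` for every `n`
  have hA0 : μ.real (A 0) = 0 := by
    have hle : ∀ n : ℕ, (n : ℝ) * μ.real (A 0) ≤ 1 := by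
      intro n
      have hsum : ∑ k ∈ Finset.range n, μ.real (A (k : ℤ)) = μ.real (⋃ k ∈ Finset.range n, A (k : ℤ)) := by
        rw [measureReal_biUnion_finset]
        · intro i _ j _ hij
          exact hdisj (by exact_mod_cast hij)
        · exact fun k _ => hAm k
      calc (n : ℝ) * μ.real (A 0) = ∑ _k ∈ Finset.range n, μ.real (A 0) := by
            rw [Finset.sum_const, Finset.card_range, nsmul_eq_mul]
        _ = ∑ k ∈ Finset.range n, μ.real (A (k : ℤ)) := Finset.sum_congr rfl fun k _ => (hshift k).symm
        _ ≤ 1 := by rw [hsum]; exact measureReal_le_one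
    by_contra hne
    have hpos : 0 < μ.real (A 0) := lt_of_le_of_ne measureReal_nonneg (Ne.symm hne)
    obtain ⟨n, hn⟩ := exists_nat_gt (1 / μ.real (A 0))
    have := hle n
    rw [div_lt_iff₀ hpos] at hn
    linarith
  have hAnull : ∀ᵐ ω ∂μ, ∀ k : ℤ, ω ∉ A k := by
    refine ae_all_iff.2 fun k => ?_
    have h0 : μ (A k) = 0 := (measureReal_eq_zero_iff (measure_ne_top _ _)).1 (by rw [hshift k, hA0])
    exact (measure_eq_zero_iff_ae_notMem).1 h0
  -- conclusion: on {0 ↔ ∞} ∩ cap ∩ uniqueness ∩ lattice, `ω ∈ A (max hit)`; so `θ(p) = 0`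
  have hae : ∀ᵐ ω ∂μ, ω ∉ percolatesAt (0 : Site d) := by
    filter_upwards [hcap, Grimmett1999_numInfiniteClusters_le_one_holds d p, ae_subset_edgeSet (zdGraph d) p, hAnull]
      with ω hB huniq hω hnot h0
    obtain ⟨B, hB0, hBdd, hBcl⟩ := hB
    set T : Set ℤ := {t : ℤ | ω ∈ percolatesAt (Pi.single 0 t : Site d)} with hT
    have hT0 : (0 : ℤ) ∈ T := by simp [hT, h0]
    have hTB : T ⊆ {t : ℤ | Function.update (0 : Site d) 0 t ∈ B} := by
      intro t ht
      have hconn : ω ∈ openConn (0 : Site d) (Pi.single 0 t : Site d) := mem_openConn_of_numInfiniteClusters_le_one huniq h0 ht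
      have hmem : (Pi.single 0 t : Site d) ∈ B :=
        mem_of_openConn_of_boundary_closed hω hBcl (hB0 (by simp)) hconn
      exact hmem
    have hTbdd : BddAbove T := (hBdd 0).mono hTB
    have hmax := Int.csSup_mem ⟨0, hT0⟩ hTbdd
    exact hnot (sSup T) ⟨hmax, fun t ht hωt => not_le.2 ht (le_csSup hTbdd hωt)⟩
  unfold theta
  rw [measureReal_eq_zero_iff (measure_ne_top _ _)]
  have h := ae_iff.1 hae
  simp only [not_not, Set.setOf_mem_eq] at h
  exact h

end PercCriticalCapsCapLemma

end Summit.CriticalPhenomena.PercolationContinuityZ3.Theorems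

end
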